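import Mathlib
import Summits.Ventures.PercRepro2.SwOutMixedArmsBaseHull
import Summits.Ventures.PercRepro2.SwOutMixedArmsBaseDual
import Summits.Ventures.PercRepro2.SwOutMixedArmsBaseLeak
import Summits.Ventures.PercRepro2.SwOutSevReal
import Summits.Ventures.PercRepro2.SwOutSevFalse

/-!
# The core points of a several-arms base: the clusters of `u`, the extended hull, the blue side
and the canonical base (blind cell PercRepro2, night-4 g22, 2026-08-27; proofs/NIGHT4-G22.md §3)

At a CORE point `q` (every arm uniform) of a several-arms base `σ`: the red cluster of `u` is the
red cluster of `h` when some u-arm is red, else `u` with the red-attached dropped vertices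
(`cluster_mixedRealR_u_core`; blue by duality, `cluster_blue_mixedRealR_u_core`); the EXTENDED
HULL is the whole structure `{h, u} ∪ range p ∪ arms` (`extHull_mixedRealR_core`, with a u-arm);
the BLUE SIDE is the vertex set of the classes assigned `false` (`blueExt_mixedRealR_core`,
`falseSetR`), whose touching edges are exactly the flipped classes
(`touches_falseSetR_eq_flipSetR`); hence the CANONICAL BASE of the realisation is the base
(`coreBaseOf_mixedRealR_core`).  These are the constancy facts of the partition along the core
points of a block, for the several-arms base in general.
-/

namespace Summit.Ventures.PercRepro2

namespace MixedArms

open Hull LocRows BigBlock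

variable {V : Type*} {E : Type*} [Fintype E] [DecidableEq E]

open scoped Classical

variable {ι ρ ν κ : Type*} {ends : E → Sym2 V} {σ : Config E} {h u : V} {U : ι → Set V}
  {p : ρ → V} {Ah : ν → Set V} {arm : ν → ρ} {F : κ → Set V}

variable (hb : MixedBaseR ends σ h u U p Ah arm F)
include hb

omit [Fintype E] [DecidableEq E] in
/-- **The red cluster of `u` at a core point**: the red cluster of `h` when some u-arm is red,
else `u` with the red-attached dropped vertices. -/
theorem MixedBaseR.cluster_mixedRealR_u_core (hup : ∀ r, ∃ e, ends e = s(u, p r))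
    {q : PtR ι ρ ν κ} (hq : Core q arm) :
    cluster ends (mixedRealR ends u U p Ah F σ q) u =
      if ∃ j, q.1 j = true then redSetR h u U p Ah F q
      else {u} ∪ {x | ∃ r, x = p r ∧ q.2.2.1 r = true} := by
  split_ifs with hs
  · -- `u` lies in the red cluster of `h`
    have hu : u ∈ cluster ends (mixedRealR ends u U p Ah F σ q) h := by
      rw [hb.cluster_mixedRealR hup (not_leakRR_of_core hq), mem_redSetR_iff]
      exact Or.inr (Or.inr (Or.inl ⟨rfl, hs⟩))
    rw [← hb.cluster_mixedRealR hup (not_leakRR_of_core hq)]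
    ext v
    constructor
    · exact fun hv => conn_trans hu hv
    · exact fun hv => conn_trans (conn_symm hu) hv
  · have hs' : ∀ j, q.1 j = false := by
      intro j
      cases hj : q.1 j with
      | true => exact absurd ⟨j, hj⟩ hs
      | false => rfl
    apply Set.Subset.antisymm
    · intro v hv
      refine mem_of_conn_of_closed (ends := ends) (ω := mixedRealR ends u U p Ah F σ q) ?_
        (Or.inl rfl) hv
      rintro x (hx | ⟨r, hxr, hr⟩) y hxy
      · rw [Set.mem_singleton_iff] at hx
        rw [hx] at hxy
        obtain ⟨_, e, he, hends⟩ := openGraph_adj.1 hxy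
        rcases hb.u_edges e y hends with ⟨j, hj⟩ | ⟨r, rfl⟩
        · exfalso
          have := hb.mixedRealR_apply_U (q := q) (j := j) ⟨y, hj, u, ends_swap hends⟩
          rw [hs' j, if_neg (by decide), hb.u_red e y hends] at this
          rw [this] at he
          exact Bool.noConfusion he
        · have := hb.mixedRealR_apply_UP (q := q) (r := r) hends
          rw [hb.u_red e (p r) hends] at this
          right
          refine ⟨r, rfl, ?_⟩
          cases hr : q.2.2.1 r with
          | true => rfl
          | false =>
            rw [hr, if_neg (by decide)] at this
            rw [this] at he
            exact Bool.noConfusion he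
      · rw [hxr] at hxy
        obtain ⟨_, e, he, hends⟩ := openGraph_adj.1 hxy
        rcases hb.p_edges r e y hends with hyu | ⟨i, hi, hy⟩ | ⟨-, -, hy⟩
        · exact Or.inl hyu
        · exfalso
          have := hb.mixedRealR_apply_Ah (q := q) (i := i) (MixedBaseR.dead_mem_touches hends hy)
          rw [hq.1 i, hi, hr, if_pos rfl, hb.dead_blue r e y hends ⟨i, hy⟩] at this
          rw [this] at he
          exact Bool.noConfusion he
        · by_cases hyu : y = u
          · exact Or.inl hyu
          exfalso
          have hyA : ∀ i, y ∉ Ah i := fun i hyi =>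
            hy (Or.inl (Or.inr (Set.mem_iUnion.2 ⟨i, hyi⟩)))
          have := hb.mixedRealR_apply_Ext (q := q) (r := r) ⟨y, hends, hyu, hyA⟩
          rw [← hq.2 r, hr, if_pos rfl, hb.ext_blue r e y hends hyu hyA] at this
          rw [this] at he
          exact Bool.noConfusion he
    · rintro v (rfl | ⟨r, rfl, hr⟩)
      · exact mem_cluster_self _ _ _
      · obtain ⟨e, he⟩ := hup r
        have := hb.mixedRealR_apply_UP (q := q) (r := r) he
        rw [hr, if_pos rfl, hb.u_red e (p r) he] at this
        exact mem_cluster_of_edge (mem_cluster_self _ _ _) this he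

omit [Fintype E] [DecidableEq E] in
/-- **The blue cluster of `u` at a core point** (by duality). -/
theorem MixedBaseR.cluster_blue_mixedRealR_u_core (hup : ∀ r, ∃ e, ends e = s(u, p r))
    {q : PtR ι ρ ν κ} (hq : Core q arm) :
    cluster ends (blue (mixedRealR ends u U p Ah F σ q)) u =
      if ∃ j, (flipPt q).1 j = true then redSetR h u U p Ah F (flipPt q)
      else {u} ∪ {x | ∃ r, x = p r ∧ (flipPt q).2.2.1 r = true} := by
  rw [hb.blue_mixedRealR]
  exact hb.dual.cluster_mixedRealR_u_core hup (core_flipPt hq)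

omit [Fintype E] [DecidableEq E] in
/-- **The extended hull at a core point is the whole structure** (with a u-arm). -/
theorem MixedBaseR.extHull_mixedRealR_core [Nonempty ι] (hup : ∀ r, ∃ e, ends e = s(u, p r))
    {q : PtR ι ρ ν κ} (hq : Core q arm) :
    extHull ends (mixedRealR ends u U p Ah F σ q) h u =
      {h} ∪ {u} ∪ Set.range p ∪ armsAllR U Ah F := by
  have hR := hb.cluster_mixedRealR hup (not_leakRR_of_core hq)
  have hB := hb.cluster_blue_mixedRealR hup (not_leakBR_of_core hq)
  have hRu := hb.cluster_mixedRealR_u_core hup hq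
  have hBu := hb.cluster_blue_mixedRealR_u_core hup hq
  have hsub : ∀ q' : PtR ι ρ ν κ, ({u} ∪ {x | ∃ r, x = p r ∧ q'.2.2.1 r = true} : Set V) ⊆
      {h} ∪ {u} ∪ Set.range p ∪ armsAllR U Ah F := by
    rintro q' x (hx | ⟨r, rfl, -⟩)
    · rw [Set.mem_singleton_iff] at hx
      rw [hx]
      exact Or.inl (Or.inl (Or.inr rfl))
    · exact Or.inl (Or.inr ⟨r, rfl⟩)
  apply Set.Subset.antisymm
  · rintro x ((hx | hx) | (hx | hx))
    · rw [hR] at hx; exact redSetR_subset hx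
    · rw [hB] at hx; exact redSetR_subset hx
    · rw [hRu] at hx
      split_ifs at hx with hs
      · exact redSetR_subset hx
      · exact hsub q hx
    · rw [hBu] at hx
      split_ifs at hx with hs
      · exact redSetR_subset hx
      · exact hsub (flipPt q) hx
  · have hRmem : ∀ x, x ∈ redSetR h u U p Ah F q →
        x ∈ extHull ends (mixedRealR ends u U p Ah F σ q) h u := fun x hx =>
      Or.inl (Or.inl (hR ▸ hx))
    have hBmem : ∀ x, x ∈ redSetR h u U p Ah F (flipPt q) →
        x ∈ extHull ends (mixedRealR ends u U p Ah F σ q) h u := fun x hx =>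
      Or.inl (Or.inr (hB ▸ hx))
    rintro x (((hx | hx) | ⟨r, rfl⟩) | hx)
    · rw [Set.mem_singleton_iff] at hx
      rw [hx]
      exact Or.inl (Or.inl (mem_cluster_self _ _ _))
    · rw [Set.mem_singleton_iff] at hx
      rw [hx]
      obtain ⟨j⟩ := ‹Nonempty ι›
      cases hj : q.1 j with
      | true =>
        apply hRmem
        rw [mem_redSetR_iff]
        exact Or.inr (Or.inr (Or.inl ⟨rfl, j, hj⟩))
      | false =>
        apply hBmem
        rw [mem_redSetR_iff]
        exact Or.inr (Or.inr (Or.inl ⟨rfl, j, by rw [flipPt_fst, hj]; rfl⟩))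
    · by_cases hs : ∃ j, q.1 j = true
      · cases hr : q.2.2.1 r with
        | true =>
          apply hRmem
          rw [mem_redSetR_iff]
          exact Or.inr (Or.inr (Or.inr (Or.inl ⟨r, rfl, hs, hr⟩)))
        | false =>
          by_cases hs' : ∃ j, q.1 j = false
          · apply hBmem
            rw [mem_redSetR_iff]
            obtain ⟨j, hj⟩ := hs'
            exact Or.inr (Or.inr (Or.inr (Or.inl ⟨r, rfl, ⟨j, by rw [flipPt_fst, hj]; rfl⟩,
              by rw [flipPt_uP, hr]; rfl⟩)))
          · right; right
            rw [hBu, if_neg (fun ⟨j, hj⟩ => hs' ⟨j, by rw [flipPt_fst] at hj; simpa using hj⟩)]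
            exact Or.inr ⟨r, rfl, by rw [flipPt_uP, hr]; rfl⟩
      · cases hr : q.2.2.1 r with
        | true =>
          right; left
          rw [hRu, if_neg hs]
          exact Or.inr ⟨r, rfl, hr⟩
        | false =>
          apply hBmem
          rw [mem_redSetR_iff]
          obtain ⟨j⟩ := ‹Nonempty ι›
          have hj : q.1 j = false := by
            cases hj : q.1 j with
            | true => exact absurd ⟨j, hj⟩ hs
            | false => rfl
          exact Or.inr (Or.inr (Or.inr (Or.inl ⟨r, rfl, ⟨j, by rw [flipPt_fst, hj]; rfl⟩,
            by rw [flipPt_uP, hr]; rfl⟩)))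
    · rcases hx with (hx | hx) | hx
      · obtain ⟨j, hj⟩ := Set.mem_iUnion.1 hx
        cases hsj : q.1 j with
        | true =>
          apply hRmem
          rw [mem_redSetR_iff]
          exact Or.inr (Or.inl ⟨j, hsj, hj⟩)
        | false =>
          apply hBmem
          rw [mem_redSetR_iff]
          exact Or.inr (Or.inl ⟨j, by rw [flipPt_fst, hsj]; rfl, hj⟩)
      · obtain ⟨i, hi⟩ := Set.mem_iUnion.1 hx
        cases hai : q.2.1 i with
        | true =>
          apply hRmem
          rw [mem_redSetR_iff]
          exact Or.inr (Or.inr (Or.inr (Or.inr (Or.inl ⟨i, hai, hi⟩))))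
        | false =>
          apply hBmem
          rw [mem_redSetR_iff]
          exact Or.inr (Or.inr (Or.inr (Or.inr (Or.inl ⟨i, by rw [flipPt_a, hai]; rfl, hi⟩))))
      · obtain ⟨k, hk⟩ := Set.mem_iUnion.1 hx
        cases hfk : q.2.2.2.2 k with
        | true =>
          apply hRmem
          rw [mem_redSetR_iff]
          exact Or.inr (Or.inr (Or.inr (Or.inr (Or.inr ⟨k, hfk, hk⟩))))
        | false =>
          apply hBmem
          rw [mem_redSetR_iff]
          exact Or.inr (Or.inr (Or.inr (Or.inr (Or.inr ⟨k, by rw [flipPt_f, hfk]; rfl, hk⟩))))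

omit [Fintype E] [DecidableEq E] in
/-- **The blue side at a core point is the vertex set of the classes assigned `false`.** -/
theorem MixedBaseR.blueExt_mixedRealR_core (hup : ∀ r, ∃ e, ends e = s(u, p r))
    {q : PtR ι ρ ν κ} (hq : Core q arm) :
    blueExt ends (mixedRealR ends u U p Ah F σ q) h u = falseSetR U p Ah F q := by
  have hB := hb.cluster_blue_mixedRealR hup (not_leakBR_of_core hq)
  have hBu := hb.cluster_blue_mixedRealR_u_core hup hq
  have hph : ∀ r, p r ≠ h := fun r => (hb.hne_hp r).symm
  have hpu : ∀ r, p r ≠ u := fun r => (hb.hne_up r).symm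
  -- a vertex of the blue cluster of `h` other than `h` and `u` is in `falseSetR`
  have hred : ∀ x, x ∈ redSetR h u U p Ah F (flipPt q) → x ≠ h → x ≠ u →
      x ∈ falseSetR U p Ah F q := by
    intro x hx hxh hxu
    rw [mem_redSetR_iff] at hx
    rw [mem_falseSetR_iff]
    rcases hx with rfl | ⟨j, hj, hx⟩ | ⟨rfl, -⟩ | ⟨r, rfl, -, hr⟩ | ⟨i, hi, hx⟩ | ⟨k, hk, hx⟩
    · exact absurd rfl hxh
    · exact Or.inl ⟨j, by rw [flipPt_fst] at hj; simpa using hj, hx⟩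
    · exact absurd rfl hxu
    · exact Or.inr (Or.inr (Or.inl ⟨r, rfl, by rw [flipPt_uP] at hr; simpa using hr⟩))
    · exact Or.inr (Or.inl ⟨i, by rw [flipPt_a] at hi; simpa using hi, hx⟩)
    · exact Or.inr (Or.inr (Or.inr ⟨k, by rw [flipPt_f] at hk; simpa using hk, hx⟩))
  ext x
  constructor
  · rintro ⟨hx | hx, hxhu⟩
    · have hxh : x ≠ h := fun h' => hxhu (Or.inl h')
      have hxu : x ≠ u := fun h' => hxhu (Or.inr h')
      rw [hB] at hx
      exact hred x hx hxh hxu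
    · have hxh : x ≠ h := fun h' => hxhu (Or.inl h')
      have hxu : x ≠ u := fun h' => hxhu (Or.inr h')
      rw [hBu] at hx
      split_ifs at hx with hs
      · exact hred x hx hxh hxu
      · rcases hx with hx | ⟨r, rfl, hr⟩
        · exact absurd hx hxu
        · rw [mem_falseSetR_iff]
          exact Or.inr (Or.inr (Or.inl ⟨r, rfl, by rw [flipPt_uP] at hr; simpa using hr⟩))
  · intro hx
    have hxp := falseSetR_subset hx
    have hxh : x ≠ h := by
      rintro rfl
      rcases hxp with ⟨r, hr⟩ | hx'
      · exact hph r hr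
      · rcases hx' with (hx' | hx') | hx'
        · obtain ⟨j, hj⟩ := Set.mem_iUnion.1 hx'; exact hb.h_notMem_U j hj
        · obtain ⟨i, hi⟩ := Set.mem_iUnion.1 hx'; exact hb.h_notMem_Ah i hi
        · obtain ⟨k, hk⟩ := Set.mem_iUnion.1 hx'; exact hb.h_notMem_F k hk
    have hxu : x ≠ u := by
      rintro rfl
      rcases hxp with ⟨r, hr⟩ | hx'
      · exact hpu r hr
      · rcases hx' with (hx' | hx') | hx'
        · obtain ⟨j, hj⟩ := Set.mem_iUnion.1 hx'; exact hb.u_notMem_U j hj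
        · obtain ⟨i, hi⟩ := Set.mem_iUnion.1 hx'; exact hb.u_notMem_Ah i hi
        · obtain ⟨k, hk⟩ := Set.mem_iUnion.1 hx'; exact hb.u_notMem_F k hk
    refine ⟨?_, fun h' => h'.elim hxh hxu⟩
    rw [mem_falseSetR_iff] at hx
    rcases hx with ⟨j, hj, hx⟩ | ⟨i, hi, hx⟩ | ⟨r, rfl, hr⟩ | ⟨k, hk, hx⟩
    · left; rw [hB, mem_redSetR_iff]
      exact Or.inr (Or.inl ⟨j, by rw [flipPt_fst, hj]; rfl, hx⟩)
    · left; rw [hB, mem_redSetR_iff]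
      exact Or.inr (Or.inr (Or.inr (Or.inr (Or.inl ⟨i, by rw [flipPt_a, hi]; rfl, hx⟩))))
    · by_cases hs : ∃ j, (flipPt q).1 j = true
      · left; rw [hB, mem_redSetR_iff]
        exact Or.inr (Or.inr (Or.inr (Or.inl ⟨r, rfl, hs, by rw [flipPt_uP, hr]; rfl⟩)))
      · right; rw [hBu, if_neg hs]
        exact Or.inr ⟨r, rfl, by rw [flipPt_uP, hr]; rfl⟩
    · left; rw [hB, mem_redSetR_iff]
      exact Or.inr (Or.inr (Or.inr (Or.inr (Or.inr ⟨k, by rw [flipPt_f, hk]; rfl, hx⟩))))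

omit [Fintype E] [DecidableEq E] in
/-- **The edges touching the blue side of a core point are the flipped classes.** -/
theorem MixedBaseR.touches_falseSetR_eq_flipSetR {q : PtR ι ρ ν κ} (hq : Core q arm) :
    touches ends (falseSetR U p Ah F q) = flipSetR ends u U p Ah F q := by
  ext e
  constructor
  · rintro ⟨x, hx, y, hxy⟩
    rw [mem_falseSetR_iff] at hx
    rcases hx with ⟨j, hj, hx⟩ | ⟨i, hi, hx⟩ | ⟨r, rfl, hr⟩ | ⟨k, hk, hx⟩
    · exact Or.inl (Or.inl (Or.inl (Or.inl ⟨j, hj, x, hx, y, hxy⟩)))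
    · exact Or.inl (Or.inl (Or.inl (Or.inr ⟨i, hi, x, hx, y, hxy⟩)))
    · rcases hb.p_edges r e y hxy with hyu | ⟨i, hi, hy⟩ | ⟨-, -, hy⟩
      · rw [hyu] at hxy
        exact Or.inl (Or.inl (Or.inr ⟨r, hr, ends_swap hxy⟩))
      · refine Or.inl (Or.inl (Or.inl (Or.inr ⟨i, ?_, MixedBaseR.dead_mem_touches hxy hy⟩)))
        rw [hq.1 i, hi, hr]
      · by_cases hyu : y = u
        · rw [hyu] at hxy
          exact Or.inl (Or.inl (Or.inr ⟨r, hr, ends_swap hxy⟩))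
        · refine Or.inl (Or.inr ⟨r, ?_, y, hxy, hyu, fun i hyi =>
            hy (Or.inl (Or.inr (Set.mem_iUnion.2 ⟨i, hyi⟩)))⟩)
          rw [← hq.2 r, hr]
    · exact Or.inr ⟨k, hk, x, hx, y, hxy⟩
  · rintro ((((⟨j, hj, x, hx, y, hxy⟩ | ⟨i, hi, x, hx, y, hxy⟩) | ⟨r, hr, hup⟩) |
      ⟨r, hr, z, hpz, -, -⟩) | ⟨k, hk, x, hx, y, hxy⟩)
    · exact ⟨x, mem_falseSetR_iff.2 (Or.inl ⟨j, hj, hx⟩), y, hxy⟩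
    · exact ⟨x, mem_falseSetR_iff.2 (Or.inr (Or.inl ⟨i, hi, hx⟩)), y, hxy⟩
    · exact ⟨p r, mem_falseSetR_iff.2 (Or.inr (Or.inr (Or.inl ⟨r, rfl, hr⟩))), u, ends_swap hup⟩
    · refine ⟨p r, mem_falseSetR_iff.2 (Or.inr (Or.inr (Or.inl ⟨r, rfl, ?_⟩))), z, hpz⟩
      rw [hq.2 r, hr]
    · exact ⟨x, mem_falseSetR_iff.2 (Or.inr (Or.inr (Or.inr ⟨k, hk, hx⟩))), y, hxy⟩

omit [Fintype E] [DecidableEq E] in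
/-- **The canonical base of the realisation of a core point is the base.** -/
theorem MixedBaseR.coreBaseOf_mixedRealR_core (hup : ∀ r, ∃ e, ends e = s(u, p r))
    {q : PtR ι ρ ν κ} (hq : Core q arm) :
    coreBaseOf ends (mixedRealR ends u U p Ah F σ q) h u = σ := by
  unfold coreBaseOf
  rw [hb.blueExt_mixedRealR_core hup hq]
  funext e
  by_cases he : e ∈ flipSetR ends u U p Ah F q
  · have he' : e ∈ touches ends (falseSetR U p Ah F q) := by
      rw [hb.touches_falseSetR_eq_flipSetR hq]; exact he
    rw [flip_apply_of_mem he']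
    unfold mixedRealR
    rw [if_pos he, Bool.not_not]
  · have he' : e ∉ touches ends (falseSetR U p Ah F q) := by
      rw [hb.touches_falseSetR_eq_flipSetR hq]; exact he
    rw [flip_apply_of_notMem he']
    unfold mixedRealR
    rw [if_neg he]

end MixedArms

end Summit.Ventures.PercRepro2
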